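import Summits.Ventures.PercRepro2.CaseOneStarPolyI
import Summits.Ventures.PercRepro2.CaseOneStarBlock21

/-!
# The marked star, `(i)`-side: the vanishing block `(2,1)`
(blind cell PercRepro2, p1 g15; S5 §2.1 (K9) (p))

`epsI21 = 2 · EredI(q₁ = 1, q₂ = 1) = 0`: with both root edges open `Q` and `Q ∩ B₁` are impossible, i.e.
the four parts of `Q` (`ptQ_sum`, CaseOneStarBlock21.lean) and of `QB1` (`ptQB1_sum`) sum to zero, and `EredI(1, 1)` is
`−(ΣQ · X − ΣQB1 · Y)` as an expression in the parts (`linear_combination`). -/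

namespace Summit.Ventures.PercRepro2

namespace CaseOne

section BlockI21
variable {R : Type*} [CommRing R]

/-- With both root edges open, `Q ∩ B₁` is impossible: the four parts of `QB1` sum to zero. -/
lemma ptQB1_sum (r s : R) (m : SCells R) :
    ptQB100 r s m + ptQB110 r s m + ptQB101 r s m + ptQB111 r s m = 0 := by
  unfold ptQB100 ptQB110 ptQB101 ptQB111
  ring

/-- **`epsI21 = 0`**. -/
theorem epsI21_eq_zero (r s : R) (m : SCells R) : epsI21 r s m = 0 := by
  unfold epsI21 cfI00 cfI01 cfI10 cfI11 cfI20 cfI21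
  linear_combination (-2 : R) * ((1 : R) * ptD00 r s m * ptQAB1O00 r s m + (1 : R) * ptD00 r s m * ptQAB1O10 r s m + (-1 : R) * ptDo00 r s m * ptQAB100 r s m + (-1 : R) * ptDo00 r s m * ptQAB110 r s m) * ptQ_sum r s m + (2 : R) * ((1 : R) * ptD00 r s m * ptQAO00 r s m + (1 : R) * ptD00 r s m * ptQAO10 r s m + (-1 : R) * ptDo00 r s m * ptQA00 r s m + (-1 : R) * ptDo00 r s m * ptQA10 r s m) * ptQB1_sum r s m

/-- The `(r, s)`-Bernstein form of `epsI21`: the block is zero. -/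
theorem epsI21_bern (r s : R) (m : SCells R) : 9 * epsI21 r s m = (0 : R) := by
  rw [epsI21_eq_zero]
  ring

end BlockI21

end CaseOne

end Summit.Ventures.PercRepro2
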